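/-
Copyright (c) 2026 The HCML crux team. All rights reserved.
Released under Apache 2.0 license as described in the file LICENSE.
Authors: K2E3-p03 (g5) (explicit-unit `hodgecm-mathlib-K2E3-p03-g5`)
-/
import Literature.NumberTheory.Automorphic.GLnStandardLeviTwoBlockModel     -- ★ `exists_continuousMulEquiv_prod_standardLeviGL_twoBlock` (`GL_k × GL_l ≃ₜ* M_c`)
import Literature.NumberTheory.Weil1964.GLnHaarOfAddHaar                   -- ★ `exists_lintegral_gl_eq_mul_lintegral` (`d^×X = c ‖det X‖^{-n} dX`)
import Literature.NumberTheory.Automorphic.GodementJacquetLocalNonvanishing -- ★ `isOpenEmbedding_generalLinearGroup_val`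
import Mathlib.MeasureTheory.Measure.Haar.Unique
import HarnessLib

/-!
# (11-3-split-nsc, brick (nsc-K𝔭-MU), file 1 of 2) The Haar measure of the (2,1) Levi subgroup `M = GL₂ × GL₁ ⊂ GL₃(F)` in additive coordinates:
# `∫_M ψ(m) dν_M = c ∫_{F⁵} 1_{det A ≠ 0, b ≠ 0} ψ(diag(A, b)) ‖det A‖⁻² ‖b‖⁻¹ d(A, b)`

Cell `hodgecm-mathlib`, Track B, line `K2_E3_EllipticInputs`; leaf (11-3-split-nsc) `sig_K2E3CharLocIntNearSemisimpleSplitThreeNonSupercuspidal` (U12 ED. 20),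
road owner K2E3-p11 (g5) (BRICK LIST v1.1, squad bus 2026-09-04T07:55:03Z, brick (nsc-K𝔭-MU) «Levi × unipotent coordinates of `P₍₂,₁₎`»; heir K2E3-p11 (g6)), dealer
K2E3-plan (g3).  `--supports stmt-HodgeConjecture-24833 --as helper`; THEOREMS ONLY (no definition ∕ instance ∕ notation ∕ named fact ∕ `sorry`); never imports
`Cruxes/…/Lines`.  COUNT-NEUTRAL.

THE RESULT.  `M = standardLeviGL F ![false, false, true] ≤ GL₃(F)` is the block-diagonal subgroup `{diag(A, b) : A ∈ GL₂(F), b ∈ F^×}` (★ two-block model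
`GL₂(F) × GL₁(F) ≃ₜ* M`, `exists_continuousMulEquiv_prod_standardLeviGL_twoBlock`).  For EVERY Haar measure `ν_M` on `M` and every additive Haar measure `dx` on `F`:
**`exists_lintegral_levi_eq_mul_lintegral_pi`** — there is ONE `c ∈ (0, ∞)` with, for every Borel `ψ : M₃(F) → [0, ∞]`,
`∫⁻ m, ψ(m) dν_M = c ∫⁻_{v ∈ F⁵} 1_{det A(v) ≠ 0 ∧ v₄ ≠ 0} ψ(!![v₀, v₁, 0; v₂, v₃, 0; 0, 0, v₄]) (‖det A(v)‖_F⁻¹)² ‖v₄‖_F⁻¹ d(⊗₅ dx)`, `A(v) = !![v₀, v₁; v₂, v₃]`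
— Haar uniqueness on `GL₂ × GL₁` against the product of ★ Weil's `‖det X‖^{-2} dX` on `GL₂(F)` and `‖y‖⁻¹ dy` on `GL₁(F)` (`GLnHaarOfAddHaar.exists_lintegral_gl_eq_mul_lintegral`),
Tonelli, and additive Haar uniqueness on `M₂(F) × M₁(F)` against `(⊗₅ dx)` in the coordinates `v ↦ (A(v), v₄)`.  File 2 (`K2E3GL3ParabolicLeviUnipotentCoordinates`) adds the
unipotent radical `U ≅ F²` and the substitution `y ↦ A y` to reach the road owner's `F⁷` form of `∫_M ∫_U g(m u)`.
[WeilBNT1967, Chap. I §4 & Chap. II §1 (Haar on `M_n` and its units); BernsteinZelevinsky1977, §2.1 (`M ≅ GL₂ × GL₁`); vanDijk1972, §2]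
HONEST LABEL: HC_CM is proved only modulo the 7 printed citations (2 remaining named inputs: hLiu418 = stmt-HodgeConjecture-24832, h413 =
stmt-HodgeConjecture-24833) until rung 0 closes; count-neutral helper.

## References
* [WeilBNT1967] A. Weil, *Basic Number Theory* (1967), Chap. I §2, §4; Chap. II §1.
* [BernsteinZelevinsky1977] I. N. Bernstein, A. V. Zelevinsky, *Induced representations of reductive 𝔭-adic groups I*, Ann. Sci. ÉNS 10 (1977), §2.1.
* [vanDijk1972] G. van Dijk, *Computation of certain induced characters of 𝔭-adic groups*, Math. Ann. 199 (1972), §2.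
-/

set_option autoImplicit false
set_option linter.dupNamespace false

noncomputable section

open MeasureTheory MeasureTheory.Measure Topology TopologicalSpace Matrix
open scoped MatrixGroups NNReal ENNReal
open Literature.NumberTheory.Automorphic Literature.NumberTheory.Weil1964
open Literature.NumberTheory.GaloisRepresentations Literature.NumberTheory.GaloisRepresentations.IsNonarchimedeanLocalField

namespace Summit.HodgeConjecture.HodgeConjecture.Cruxes.H413.K2E3GL3LeviHaarCoordinates

variable {F : Type*} [Field F] [ValuativeRel F] [TopologicalSpace F] [IsNonarchimedeanLocalField F]

/-! ## §1  Frame: `GL_k(F)` is second countable and locally compact -/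

omit [ValuativeRel F] [IsNonarchimedeanLocalField F] in
/-- `GL_k(F)` is second countable and locally compact for a second countable, locally compact, `T1` topological field with continuous inversion
(open subspace of `M_k(F)`, ★ `isOpenEmbedding_generalLinearGroup_val`). [folklore] -/
theorem secondCountable_and_locallyCompact_gl [IsTopologicalRing F] [ContinuousInv₀ F] [T1Space F] [SecondCountableTopology F] [LocallyCompactSpace F]
    (k : ℕ) : SecondCountableTopology (GL (Fin k) F) ∧ LocallyCompactSpace (GL (Fin k) F) := by
  haveI : SecondCountableTopology (Matrix (Fin k) (Fin k) F) := by
    change SecondCountableTopology (Fin k → Fin k → F); infer_instance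
  haveI : LocallyCompactSpace (Matrix (Fin k) (Fin k) F) := by
    change LocallyCompactSpace (Fin k → Fin k → F); infer_instance
  exact ⟨(isOpenEmbedding_generalLinearGroup_val (m := Fin k) (F := F)).isEmbedding.secondCountableTopology,
    (isOpenEmbedding_generalLinearGroup_val (m := Fin k) (F := F)).locallyCompactSpace⟩

/-! ## §2  The two-block model `GL₂(F) × GL₁(F) ≃ₜ* M` with its matrix, for the road's label `![false, false, true]` -/

omit [ValuativeRel F] [TopologicalSpace F] [IsNonarchimedeanLocalField F] in
/-- The two-block labelling `i ↦ [2 ≤ i]` of `Fin (2 + 1)` IS the road's label `![false, false, true]`. [folklore] -/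
theorem twoBlockLabel_two_one_eq : (fun i : Fin (2 + 1) => decide (2 ≤ (i : ℕ))) = (![false, false, true] : Fin 3 → Bool) := by
  funext i
  fin_cases i <;> rfl

omit [ValuativeRel F] [IsNonarchimedeanLocalField F] in
/-- **The (2,1) Levi model with its matrix**: an isomorphism of topological groups `e : GL₂(F) × GL₁(F) ≃ₜ* M = standardLeviGL F ![false,false,true]` with
`↑(e (a, b)) = !![a₀₀, a₀₁, 0; a₁₀, a₁₁, 0; 0, 0, b₀₀]` (★ `exists_continuousMulEquiv_prod_standardLeviGL_twoBlock` at `(k, l) = (2, 1)`, the label cast, and the entries of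
`reindex finSumFinEquiv (fromBlocks a 0 0 b)`). [cite: BernsteinZelevinsky1977, §2.1] -/
theorem exists_continuousMulEquiv_prod_levi [IsTopologicalRing F] :
    ∃ e : (GL (Fin 2) F × GL (Fin 1) F) ≃ₜ* ↥(standardLeviGL F (![false, false, true] : Fin 3 → Bool)),
      ∀ x : GL (Fin 2) F × GL (Fin 1) F,
        (((e x : ↥(standardLeviGL F (![false, false, true] : Fin 3 → Bool))) : GL (Fin 3) F) : Matrix (Fin 3) (Fin 3) F) =
          !![(x.1 : Matrix (Fin 2) (Fin 2) F) 0 0, (x.1 : Matrix (Fin 2) (Fin 2) F) 0 1, 0;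
             (x.1 : Matrix (Fin 2) (Fin 2) F) 1 0, (x.1 : Matrix (Fin 2) (Fin 2) F) 1 1, 0;
             0, 0, (x.2 : Matrix (Fin 1) (Fin 1) F) 0 0] := by
  obtain ⟨e₀, he₀⟩ := exists_continuousMulEquiv_prod_standardLeviGL_twoBlock F 2 1
  have hM : standardLeviGL F (fun i : Fin (2 + 1) => decide (2 ≤ (i : ℕ))) = standardLeviGL F (![false, false, true] : Fin 3 → Bool) := by
    rw [twoBlockLabel_two_one_eq]
  -- the label cast as an isomorphism of topological groups (identity on `GL₃(F)`)
  let ι : ↥(standardLeviGL F (fun i : Fin (2 + 1) => decide (2 ≤ (i : ℕ)))) ≃ₜ* ↥(standardLeviGL F (![false, false, true] : Fin 3 → Bool)) :=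
    { MulEquiv.subgroupCongr hM with
      continuous_toFun := by
        refine Continuous.subtype_mk continuous_subtype_val _
      continuous_invFun := by
        refine Continuous.subtype_mk continuous_subtype_val _ }
  have hι : ∀ m, ((ι m : ↥(standardLeviGL F (![false, false, true] : Fin 3 → Bool))) : GL (Fin 3) F) = (m : GL (Fin (2 + 1)) F) := fun m => rfl
  refine ⟨e₀.trans ι, fun x => ?_⟩
  have h1 : ((((e₀.trans ι) x : ↥(standardLeviGL F (![false, false, true] : Fin 3 → Bool))) : GL (Fin 3) F) : Matrix (Fin 3) (Fin 3) F) =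
      (((e₀ x : ↥(standardLeviGL F (fun i : Fin (2 + 1) => decide (2 ≤ (i : ℕ)))))) : GL (Fin (2 + 1)) F) := by
    rw [ContinuousMulEquiv.trans_apply, hι]
  rw [h1, he₀ x, UnitaryGroup.coe_reindexGL, UnitaryGroup.coe_blockDiagGL]
  have hs0 : (finSumFinEquiv : Fin 2 ⊕ Fin 1 ≃ Fin (2 + 1)).symm 0 = Sum.inl 0 := by decide
  have hs1 : (finSumFinEquiv : Fin 2 ⊕ Fin 1 ≃ Fin (2 + 1)).symm 1 = Sum.inl 1 := by decide
  have hs2 : (finSumFinEquiv : Fin 2 ⊕ Fin 1 ≃ Fin (2 + 1)).symm 2 = Sum.inr 0 := by decide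
  ext i j
  fin_cases i <;> fin_cases j <;>
    simp [Matrix.reindex_apply, Matrix.submatrix_apply, hs0, hs1, hs2, Matrix.fromBlocks_apply₁₁, Matrix.fromBlocks_apply₁₂,
      Matrix.fromBlocks_apply₂₁, Matrix.fromBlocks_apply₂₂]

/-! ## §3  Every Haar measure on `M` in the additive coordinates `F⁵ = M₂(F) × F` -/

omit [ValuativeRel F] [IsNonarchimedeanLocalField F] in
/-- The coordinate map `v ↦ (!![v₀, v₁; v₂, v₃], !![v₄])` as an ADDITIVE homeomorphism `F⁵ ≃ M₂(F) × M₁(F)` (existence form with both structures on one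
underlying function). [folklore] -/
theorem exists_coordEquiv :
    ∃ (Φ : (Fin 5 → F) ≃ₜ (Matrix (Fin 2) (Fin 2) F × Matrix (Fin 1) (Fin 1) F)) (Φa : (Fin 5 → F) ≃+ (Matrix (Fin 2) (Fin 2) F × Matrix (Fin 1) (Fin 1) F)),
      (∀ v, Φ v = (!![v 0, v 1; v 2, v 3], !![v 4])) ∧ ∀ v, Φa v = Φ v := by
  let toF : (Fin 5 → F) → Matrix (Fin 2) (Fin 2) F × Matrix (Fin 1) (Fin 1) F := fun v => (!![v 0, v 1; v 2, v 3], !![v 4])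
  let invF : Matrix (Fin 2) (Fin 2) F × Matrix (Fin 1) (Fin 1) F → (Fin 5 → F) := fun p => ![p.1 0 0, p.1 0 1, p.1 1 0, p.1 1 1, p.2 0 0]
  have hl : Function.LeftInverse invF toF := fun v => by
    funext i; fin_cases i <;> rfl
  have hr : Function.RightInverse invF toF := fun p => by
    refine Prod.ext ?_ ?_
    · ext i j; fin_cases i <;> fin_cases j <;> rfl
    · ext i j; fin_cases i; fin_cases j; rfl
  have hc : Continuous toF := by
    refine Continuous.prodMk (continuous_matrix fun i j => ?_) (continuous_matrix fun i j => ?_)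
    · fin_cases i <;> fin_cases j <;> simp <;> exact continuous_apply _
    · fin_cases i; fin_cases j; simp; exact continuous_apply _
  have hci : Continuous invF := by
    refine continuous_pi fun i => ?_
    fin_cases i <;> simp [invF]
    · exact (continuous_apply_apply 0 0).comp continuous_fst
    · exact (continuous_apply_apply 0 1).comp continuous_fst
    · exact (continuous_apply_apply 1 0).comp continuous_fst
    · exact (continuous_apply_apply 1 1).comp continuous_fst
    · exact (continuous_apply_apply 0 0).comp continuous_snd
  let E : (Fin 5 → F) ≃ (Matrix (Fin 2) (Fin 2) F × Matrix (Fin 1) (Fin 1) F) := ⟨toF, invF, hl, hr⟩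
  refine ⟨⟨E, hc, hci⟩, ⟨E, fun v w => ?_⟩, fun v => rfl, fun v => rfl⟩
  refine Prod.ext ?_ ?_
  · ext i j; fin_cases i <;> fin_cases j <;> rfl
  · ext i j; fin_cases i; fin_cases j; rfl

omit [ValuativeRel F] [IsNonarchimedeanLocalField F] in
/-- The Levi matrix `diag(X, Y)` as a continuous function of `(X, Y) ∈ M₂(F) × M₁(F)`. [folklore] -/
theorem continuous_leviMatrix [IsTopologicalRing F] :
    Continuous fun p : Matrix (Fin 2) (Fin 2) F × Matrix (Fin 1) (Fin 1) F =>
      (!![p.1 0 0, p.1 0 1, 0; p.1 1 0, p.1 1 1, 0; 0, 0, p.2 0 0] : Matrix (Fin 3) (Fin 3) F) := by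
  refine continuous_matrix fun i j => ?_
  fin_cases i <;> fin_cases j <;> simp
  · exact (continuous_apply_apply 0 0).comp continuous_fst
  · exact (continuous_apply_apply 0 1).comp continuous_fst
  · exact continuous_const
  · exact (continuous_apply_apply 1 0).comp continuous_fst
  · exact (continuous_apply_apply 1 1).comp continuous_fst
  · exact continuous_const
  · exact continuous_const
  · exact continuous_const
  · exact (continuous_apply_apply 0 0).comp continuous_snd

/-- **EVERY HAAR MEASURE ON THE (2,1) LEVI `M ⊂ GL₃(F)` IN ADDITIVE COORDINATES.**  For a Haar measure `ν_M` on `M = standardLeviGL F ![false, false, true]` and an additive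
Haar measure `dx` on `F` there is ONE `c ∈ (0, ∞)` with, for every Borel `ψ : M₃(F) → [0, ∞]`:
`∫⁻ m, ψ(m) dν_M = c ∫⁻_{v ∈ F⁵} 1_{det A(v) ≠ 0 ∧ v₄ ≠ 0} ψ(!![v₀, v₁, 0; v₂, v₃, 0; 0, 0, v₄]) (‖det A(v)‖_F⁻¹)² ‖v₄‖_F⁻¹ d(⊗₅ dx)`, `A(v) = !![v₀, v₁; v₂, v₃]`.
[cite: WeilBNT1967, Chap. I §4] [cite: BernsteinZelevinsky1977, §2.1] -/
theorem exists_lintegral_levi_eq_mul_lintegral_pi [MeasurableSpace F] [BorelSpace F]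
    [MeasurableSpace ↥(standardLeviGL F (![false, false, true] : Fin 3 → Bool))] [BorelSpace ↥(standardLeviGL F (![false, false, true] : Fin 3 → Bool))]
    [MeasurableSpace (Matrix (Fin 3) (Fin 3) F)] [BorelSpace (Matrix (Fin 3) (Fin 3) F)]
    (νM : Measure ↥(standardLeviGL F (![false, false, true] : Fin 3 → Bool))) [IsHaarMeasure νM] (dx : Measure F) [dx.IsAddHaarMeasure] :
    ∃ c : ℝ≥0∞, c ≠ 0 ∧ c ≠ ∞ ∧ ∀ ψ : Matrix (Fin 3) (Fin 3) F → ℝ≥0∞, Measurable ψ →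
      ∫⁻ m, ψ ((m : GL (Fin 3) F) : Matrix (Fin 3) (Fin 3) F) ∂νM =
        c * ∫⁻ v : Fin 5 → F, {v : Fin 5 → F | (!![v 0, v 1; v 2, v 3] : Matrix (Fin 2) (Fin 2) F).det ≠ 0 ∧ v 4 ≠ 0}.indicator
          (fun v => ψ !![v 0, v 1, 0; v 2, v 3, 0; 0, 0, v 4] *
            (((normAbs F ((!![v 0, v 1; v 2, v 3] : Matrix (Fin 2) (Fin 2) F).det)⁻¹ : ℝ≥0) : ℝ≥0∞) ^ 2 * ((normAbs F (v 4)⁻¹ : ℝ≥0) : ℝ≥0∞))) v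
          ∂(Measure.pi fun _ : Fin 5 => dx) := by
  classical
  -- frame
  haveI : IsTopologicalRing F := inferInstance
  haveI : T2Space F := (isLocalField F).toT2Space
  haveI : LocallyCompactSpace F := (isLocalField F).toLocallyCompactSpace
  haveI : SecondCountableTopology F := secondCountableTopology_localField F
  letI : MeasurableSpace (GL (Fin 2) F) := borel _
  haveI : BorelSpace (GL (Fin 2) F) := ⟨rfl⟩
  letI : MeasurableSpace (GL (Fin 1) F) := borel _
  haveI : BorelSpace (GL (Fin 1) F) := ⟨rfl⟩
  obtain ⟨h2s, h2l⟩ := secondCountable_and_locallyCompact_gl (F := F) 2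
  obtain ⟨h1s, h1l⟩ := secondCountable_and_locallyCompact_gl (F := F) 1
  haveI := h2s; haveI := h2l; haveI := h1s; haveI := h1l
  haveI : SecondCountableTopology (Matrix (Fin 2) (Fin 2) F) := by change SecondCountableTopology (Fin 2 → Fin 2 → F); infer_instance
  haveI : SecondCountableTopology (Matrix (Fin 1) (Fin 1) F) := by change SecondCountableTopology (Fin 1 → Fin 1 → F); infer_instance
  haveI : LocallyCompactSpace (Matrix (Fin 2) (Fin 2) F) := by change LocallyCompactSpace (Fin 2 → Fin 2 → F); infer_instance
  haveI : LocallyCompactSpace (Matrix (Fin 1) (Fin 1) F) := by change LocallyCompactSpace (Fin 1 → Fin 1 → F); infer_instance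
  letI : MeasurableSpace (Matrix (Fin 2) (Fin 2) F) := borel _
  haveI : BorelSpace (Matrix (Fin 2) (Fin 2) F) := ⟨rfl⟩
  letI : MeasurableSpace (Matrix (Fin 1) (Fin 1) F) := borel _
  haveI : BorelSpace (Matrix (Fin 1) (Fin 1) F) := ⟨rfl⟩
  -- the model `e : GL₂ × GL₁ ≃ₜ* M` and Haar uniqueness on `GL₂ × GL₁`
  obtain ⟨e, he⟩ := exists_continuousMulEquiv_prod_levi (F := F)
  haveI : SecondCountableTopology ↥(standardLeviGL F (![false, false, true] : Fin 3 → Bool)) := e.symm.toHomeomorph.secondCountableTopology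
  haveI : LocallyCompactSpace ↥(standardLeviGL F (![false, false, true] : Fin 3 → Bool)) := e.symm.toHomeomorph.isClosedEmbedding.locallyCompactSpace
  set ρ₂ : Measure (GL (Fin 2) F) := Measure.haar with hρ₂
  set ρ₁ : Measure (GL (Fin 1) F) := Measure.haar with hρ₁
  haveI : IsHaarMeasure ((νM.map e.symm : Measure (GL (Fin 2) F × GL (Fin 1) F))) := ContinuousMulEquiv.isHaarMeasure_map νM e.symm
  have huniq : (νM.map e.symm : Measure (GL (Fin 2) F × GL (Fin 1) F)) = (νM.map e.symm).haarScalarFactor (ρ₂.prod ρ₁) • ρ₂.prod ρ₁ :=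
    isMulLeftInvariant_eq_smul _ _
  set c₀ : ℝ≥0 := (νM.map e.symm).haarScalarFactor (ρ₂.prod ρ₁) with hc₀
  have hc₀pos : 0 < c₀ := haarScalarFactor_pos_of_isHaarMeasure _ _
  -- Weil on each factor, against coordinate-friendly additive Haar measures
  obtain ⟨Φ, Φa, hΦ, hΦa⟩ := exists_coordEquiv (F := F)
  set dX : Measure (Matrix (Fin 2) (Fin 2) F × Matrix (Fin 1) (Fin 1) F) := (Measure.pi fun _ : Fin 5 => dx).map Φ with hdX
  haveI hdXH : dX.IsAddHaarMeasure := by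
    have h := AddEquiv.isAddHaarMeasure_map (Measure.pi fun _ : Fin 5 => dx) Φa (by rw [show (Φa : (Fin 5 → F) → _) = Φ from funext hΦa]; exact Φ.continuous)
      (by
        have : (Φa.symm : _ → (Fin 5 → F)) = Φ.symm := by
          funext p; exact Φa.injective (by rw [AddEquiv.apply_symm_apply, hΦa, Homeomorph.apply_symm_apply])
        rw [this]; exact Φ.symm.continuous)
    have hfun : (Φa : (Fin 5 → F) → _) = Φ := funext hΦa
    rw [hfun] at h
    exact h
  set dX₂ : Measure (Matrix (Fin 2) (Fin 2) F) := Measure.addHaar with hdX₂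
  set dX₁ : Measure (Matrix (Fin 1) (Fin 1) F) := Measure.addHaar with hdX₁
  obtain ⟨c₂, hc₂pos, hW₂⟩ := exists_lintegral_gl_eq_mul_lintegral dX₂ ρ₂
  obtain ⟨c₁, hc₁pos, hW₁⟩ := exists_lintegral_gl_eq_mul_lintegral dX₁ ρ₁
  -- additive Haar uniqueness on `M₂ × M₁`: `dX₂ ⊗ dX₁ = c₃ • Φ_*(⊗₅ dx)`
  have huniq' : dX₂.prod dX₁ = (dX₂.prod dX₁).addHaarScalarFactor dX • dX := isAddLeftInvariant_eq_smul _ _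
  set c₃ : ℝ≥0 := (dX₂.prod dX₁).addHaarScalarFactor dX with hc₃
  have hc₃pos : 0 < c₃ := addHaarScalarFactor_pos_of_isAddHaarMeasure _ _
  refine ⟨(c₀ : ℝ≥0∞) * c₂ * c₁ * c₃, ?_, ?_, fun ψ hψ => ?_⟩
  · exact mul_ne_zero (mul_ne_zero (mul_ne_zero (ENNReal.coe_ne_zero.2 hc₀pos.ne') (ENNReal.coe_ne_zero.2 hc₂pos.ne')) (ENNReal.coe_ne_zero.2 hc₁pos.ne'))
      (ENNReal.coe_ne_zero.2 hc₃pos.ne')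
  · exact ENNReal.mul_ne_top (ENNReal.mul_ne_top (ENNReal.mul_ne_top ENNReal.coe_ne_top ENNReal.coe_ne_top) ENNReal.coe_ne_top) ENNReal.coe_ne_top
  -- the integrand read on `GL₂ × GL₁` and on `M₂ × M₁`
  set Ψ : Matrix (Fin 2) (Fin 2) F → Matrix (Fin 1) (Fin 1) F → ℝ≥0∞ := fun X Y => ψ !![X 0 0, X 0 1, 0; X 1 0, X 1 1, 0; 0, 0, Y 0 0] with hΨ
  have hΨm : Measurable fun p : Matrix (Fin 2) (Fin 2) F × Matrix (Fin 1) (Fin 1) F => Ψ p.1 p.2 := hψ.comp continuous_leviMatrix.measurable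
  have hΨm₂ : ∀ X : Matrix (Fin 2) (Fin 2) F, Measurable (Ψ X) := fun X => hΨm.comp (measurable_const.prodMk measurable_id)
  -- STEP 1: transport to `GL₂ × GL₁` and apply uniqueness + Tonelli
  have hG : Measurable fun x : GL (Fin 2) F × GL (Fin 1) F => Ψ (x.1 : Matrix (Fin 2) (Fin 2) F) (x.2 : Matrix (Fin 1) (Fin 1) F) :=
    hΨm.comp ((Units.continuous_val.comp continuous_fst).prodMk (Units.continuous_val.comp continuous_snd)).measurable
  have h1 : ∫⁻ m, ψ ((m : GL (Fin 3) F) : Matrix (Fin 3) (Fin 3) F) ∂νM =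
      ∫⁻ x, Ψ (x.1 : Matrix (Fin 2) (Fin 2) F) (x.2 : Matrix (Fin 1) (Fin 1) F) ∂(νM.map e.symm) := by
    rw [show (νM.map e.symm : Measure (GL (Fin 2) F × GL (Fin 1) F)) = νM.map e.symm.toHomeomorph.toMeasurableEquiv from rfl, lintegral_map_equiv]
    refine lintegral_congr fun m => ?_
    have hm : ((m : GL (Fin 3) F) : Matrix (Fin 3) (Fin 3) F) = (((e (e.symm m) : ↥(standardLeviGL F (![false, false, true] : Fin 3 → Bool))) : GL (Fin 3) F) : Matrix (Fin 3) (Fin 3) F) := by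
      rw [ContinuousMulEquiv.apply_symm_apply]
    rw [hm, he]
    rfl
  have h2 : ∫⁻ x, Ψ (x.1 : Matrix (Fin 2) (Fin 2) F) (x.2 : Matrix (Fin 1) (Fin 1) F) ∂(νM.map e.symm) =
      c₀ * ∫⁻ a, ∫⁻ b, Ψ (a : Matrix (Fin 2) (Fin 2) F) (b : Matrix (Fin 1) (Fin 1) F) ∂ρ₁ ∂ρ₂ := by
    rw [huniq, lintegral_smul_measure, lintegral_prod _ hG.aemeasurable]
    rfl
  -- STEP 2: Weil on the inner `GL₁` and the outer `GL₂` integral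
  have hinner : ∀ a : GL (Fin 2) F, ∫⁻ b, Ψ (a : Matrix (Fin 2) (Fin 2) F) (b : Matrix (Fin 1) (Fin 1) F) ∂ρ₁ =
      c₁ * ∫⁻ Y in {Y : Matrix (Fin 1) (Fin 1) F | IsUnit Y}, Ψ (a : Matrix (Fin 2) (Fin 2) F) Y * ((normAbs F Y.det⁻¹ : ℝ≥0) : ℝ≥0∞) ^ Fintype.card (Fin 1) ∂dX₁ :=
    fun a => hW₁ _ (hΨm₂ _)
  set H : Matrix (Fin 2) (Fin 2) F → ℝ≥0∞ := fun X =>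
    ∫⁻ Y in {Y : Matrix (Fin 1) (Fin 1) F | IsUnit Y}, Ψ X Y * ((normAbs F Y.det⁻¹ : ℝ≥0) : ℝ≥0∞) ^ Fintype.card (Fin 1) ∂dX₁ with hH
  have hwt₁ : Measurable fun Y : Matrix (Fin 1) (Fin 1) F => ((normAbs F Y.det⁻¹ : ℝ≥0) : ℝ≥0∞) ^ Fintype.card (Fin 1) := measurable_glDensity
  have hwt₂ : Measurable fun X : Matrix (Fin 2) (Fin 2) F => ((normAbs F X.det⁻¹ : ℝ≥0) : ℝ≥0∞) ^ Fintype.card (Fin 2) := measurable_glDensity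
  have hjoint : Measurable fun p : Matrix (Fin 2) (Fin 2) F × Matrix (Fin 1) (Fin 1) F => Ψ p.1 p.2 * ((normAbs F p.2.det⁻¹ : ℝ≥0) : ℝ≥0∞) ^ Fintype.card (Fin 1) :=
    hΨm.mul (hwt₁.comp measurable_snd)
  have hHm : Measurable H := by
    rw [hH]
    exact hjoint.lintegral_prod_right'
  have houter : ∫⁻ a, H (a : Matrix (Fin 2) (Fin 2) F) ∂ρ₂ =
      c₂ * ∫⁻ X in {X : Matrix (Fin 2) (Fin 2) F | IsUnit X}, H X * ((normAbs F X.det⁻¹ : ℝ≥0) : ℝ≥0∞) ^ Fintype.card (Fin 2) ∂dX₂ := hW₂ _ hHm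
  have h3 : ∫⁻ a, ∫⁻ b, Ψ (a : Matrix (Fin 2) (Fin 2) F) (b : Matrix (Fin 1) (Fin 1) F) ∂ρ₁ ∂ρ₂ = c₁ * ∫⁻ a, H (a : Matrix (Fin 2) (Fin 2) F) ∂ρ₂ := by
    simp_rw [hinner]
    rw [lintegral_const_mul' _ _ ENNReal.coe_ne_top]
  -- STEP 3: back to one integral over `M₂ × M₁` against `dX₂ ⊗ dX₁`, as an indicator integrand
  set Θ : Matrix (Fin 2) (Fin 2) F × Matrix (Fin 1) (Fin 1) F → ℝ≥0∞ := fun p =>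
    ({X : Matrix (Fin 2) (Fin 2) F | IsUnit X} ×ˢ {Y : Matrix (Fin 1) (Fin 1) F | IsUnit Y}).indicator
      (fun p => Ψ p.1 p.2 * (((normAbs F p.1.det⁻¹ : ℝ≥0) : ℝ≥0∞) ^ Fintype.card (Fin 2) * ((normAbs F p.2.det⁻¹ : ℝ≥0) : ℝ≥0∞) ^ Fintype.card (Fin 1))) p with hΘ
  have hU₂ : MeasurableSet {X : Matrix (Fin 2) (Fin 2) F | IsUnit X} := by
    have : {X : Matrix (Fin 2) (Fin 2) F | IsUnit X} = (fun X : Matrix (Fin 2) (Fin 2) F => X.det) ⁻¹' {0}ᶜ := by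
      ext X; simp [Matrix.isUnit_iff_isUnit_det, isUnit_iff_ne_zero]
    rw [this]
    exact (continuous_id.matrix_det).measurable (measurableSet_singleton 0).compl
  have hU₁ : MeasurableSet {Y : Matrix (Fin 1) (Fin 1) F | IsUnit Y} := by
    have : {Y : Matrix (Fin 1) (Fin 1) F | IsUnit Y} = (fun Y : Matrix (Fin 1) (Fin 1) F => Y.det) ⁻¹' {0}ᶜ := by
      ext Y; simp [Matrix.isUnit_iff_isUnit_det, isUnit_iff_ne_zero]
    rw [this]
    exact (continuous_id.matrix_det).measurable (measurableSet_singleton 0).compl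
  have hΘ' : Measurable fun p : Matrix (Fin 2) (Fin 2) F × Matrix (Fin 1) (Fin 1) F =>
      Ψ p.1 p.2 * (((normAbs F p.1.det⁻¹ : ℝ≥0) : ℝ≥0∞) ^ Fintype.card (Fin 2) * ((normAbs F p.2.det⁻¹ : ℝ≥0) : ℝ≥0∞) ^ Fintype.card (Fin 1)) :=
    hΨm.mul ((hwt₂.comp measurable_fst).mul (hwt₁.comp measurable_snd))
  have h4 : ∫⁻ X in {X : Matrix (Fin 2) (Fin 2) F | IsUnit X}, H X * ((normAbs F X.det⁻¹ : ℝ≥0) : ℝ≥0∞) ^ Fintype.card (Fin 2) ∂dX₂ = ∫⁻ p, Θ p ∂(dX₂.prod dX₁) := by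
    rw [hΘ, lintegral_indicator (hU₂.prod hU₁), ← Measure.prod_restrict, lintegral_prod _ hΘ'.aemeasurable]
    refine lintegral_congr fun X => ?_
    rw [hH, ← lintegral_mul_const' _ _ (ENNReal.pow_ne_top ENNReal.coe_ne_top)]
    refine lintegral_congr fun Y => ?_
    ring
  -- STEP 4: additive Haar uniqueness on `M₂ × M₁` and the coordinates `Φ`
  have h5 : ∫⁻ p, Θ p ∂(dX₂.prod dX₁) = c₃ * ∫⁻ v, Θ (Φ v) ∂(Measure.pi fun _ : Fin 5 => dx) := by
    rw [huniq', lintegral_smul_measure, hdX, show ((Measure.pi fun _ : Fin 5 => dx).map Φ) = (Measure.pi fun _ : Fin 5 => dx).map Φ.toMeasurableEquiv from rfl,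
      lintegral_map_equiv]
    rfl
  -- STEP 5: the integrand in coordinates
  have h6 : ∀ v : Fin 5 → F, Θ (Φ v) = {v : Fin 5 → F | (!![v 0, v 1; v 2, v 3] : Matrix (Fin 2) (Fin 2) F).det ≠ 0 ∧ v 4 ≠ 0}.indicator
      (fun v => ψ !![v 0, v 1, 0; v 2, v 3, 0; 0, 0, v 4] *
        (((normAbs F ((!![v 0, v 1; v 2, v 3] : Matrix (Fin 2) (Fin 2) F).det)⁻¹ : ℝ≥0) : ℝ≥0∞) ^ 2 * ((normAbs F (v 4)⁻¹ : ℝ≥0) : ℝ≥0∞))) v := by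
    intro v
    rw [hΘ, hΦ v]
    beta_reduce
    have hmem : ((!![v 0, v 1; v 2, v 3], !![v 4]) : Matrix (Fin 2) (Fin 2) F × Matrix (Fin 1) (Fin 1) F) ∈
        ({X : Matrix (Fin 2) (Fin 2) F | IsUnit X} ×ˢ {Y : Matrix (Fin 1) (Fin 1) F | IsUnit Y}) ↔
        v ∈ {v : Fin 5 → F | (!![v 0, v 1; v 2, v 3] : Matrix (Fin 2) (Fin 2) F).det ≠ 0 ∧ v 4 ≠ 0} := by
      simp only [Set.mem_prod, Set.mem_setOf_eq, Matrix.isUnit_iff_isUnit_det, isUnit_iff_ne_zero, Matrix.det_fin_one, Matrix.of_apply,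
        Matrix.cons_val', Matrix.cons_val_fin_one]
    by_cases hv : v ∈ {v : Fin 5 → F | (!![v 0, v 1; v 2, v 3] : Matrix (Fin 2) (Fin 2) F).det ≠ 0 ∧ v 4 ≠ 0}
    · rw [Set.indicator_of_mem (hmem.2 hv), Set.indicator_of_mem hv]
      simp only [Fintype.card_fin, pow_one, Matrix.det_fin_one, Matrix.of_apply, Matrix.cons_val', Matrix.cons_val_fin_one]
      rfl
    · rw [Set.indicator_of_notMem (fun h => hv (hmem.1 h)), Set.indicator_of_notMem hv]
  -- assemble
  rw [h1, h2, h3, houter, h4, h5]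
  simp_rw [h6]
  ring

end Summit.HodgeConjecture.HodgeConjecture.Cruxes.H413.K2E3GL3LeviHaarCoordinates

end
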